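import Literature.Algebra.EuclideanLattices.SmoothingGaussianTail
import HarnessLib

/-!
# MR07 Lemma 4.5 and Cor. 4.6: Fourier coefficients of `D_{Λ,s,c}` above the smoothing parameter — proved

Topic `Algebra/EuclideanLattices` (family `pqc`), sequel of `SmoothingGaussianTail.lean`; serves the
decomposition of Micciancio–Regev 2007, Thm. 5.23
(`Literature.Computability.Cryptography.MicciancioRegev2007_gapCVP'_to_SIS'`): the heart of its
NO-case analysis, eq. (16) (authors' version p. 30: "By Corollary 4.6, Equation (15), and
`dist(-zⱼt, L(B)) > γd = 2√n/s`, we obtain `Exp[cos(2π⟨t, w⟩)] ≤ (1+ε)/(1-ε) · 2⁻ⁿ`"), is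
**Cor. 4.6**: for `0 < ε < 1`, `s ≥ η_ε(Λ)`, `dist(v, Λ*) ≥ √n/s` and any `w, c`,
`Exp_{x ∼ D_{Λ,s,c}}[cos(2π⟨x + w, v⟩)] ≤ (1+ε)/(1-ε) · 2⁻ⁿ`. Everything here is PROVED; theorems only.
Notation as in the prequels; `𝐞(t) = e^{2πit}` is `Real.fourierChar`.

## Results (full-rank lattice `L` of the `n`-dimensional space `V`, `0 < s`)

* `fourier_fourierChar_smul` — the modulation rule `𝓕[𝐞(⟪·, v⟫) f](w) = 𝓕 f (w - v)` (from the
  definition of the Fourier integral; Mathlib records translation, not modulation).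
* `tsum_fourierChar_smul_gaussianFunction_sub_eq` — **the modulated Poisson identity**
  `∑_{x ∈ L} 𝐞(⟪x, v⟫) ρ_s(x - c) = vol(L)⁻¹ sⁿ ∑_{y ∈ L*} 𝐞(-⟪c, y - v⟫) ρ_{1/s}(y - v)` (MR07, proof
  of Lemma 4.5, eq. (11) with `ĝ(y) = ρ̂_c(y - v)`; Poisson summation = the tree's
  `Literature.NumberTheory.LFunctions.Fourier.tsum_eq_tsum_fourier_of_rpow_decay`, Neukirch VII (3.2)).
* `norm_tsum_fourierChar_smul_gaussianFunction_sub_le` — `|∑_{x ∈ L} 𝐞(⟪x, v⟫) ρ_s(x - c)| ≤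
  vol(L)⁻¹ sⁿ ρ_{1/s}(L* - v)`.
* `tsum_gaussianFunction_dual_le_one_add` — `ρ_{1/s}(L*) ≤ 1 + ε` for `s ≥ η_ε(L)`.
* `norm_tsum_fourierChar_smul_gaussianFunction_sub_div_le` — **MR07 Lemma 4.5**: for `0 < ε < 1`,
  `η_ε(L) ≤ s`, `dist(v, L*) ≥ √n/s`: `|Exp_{x ∼ D_{L,s,c}}[𝐞(⟪x, v⟫)]| ≤ (1+ε)/(1-ε) · 2⁻ⁿ`, as the
  quotient of series. Proof as printed (pp. 15–16): numerator `≤ vol⁻¹ sⁿ ρ_{1/s}(L* - v) ≤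
  vol⁻¹ sⁿ 2⁻ⁿ ρ_{1/s}(L*) ≤ vol⁻¹ sⁿ 2⁻ⁿ (1 + ε)` (Aharonov–Regev Lemma 3.1 form of Banaszczyk's bound,
  `tsum_gaussianFunction_sub_le_pow_mul_of_forall_le`), denominator `≥ (1 - ε) sⁿ/vol`.
* `tsum_gaussianFunction_sub_mul_cos_div_le` — **MR07 Cor. 4.6** (series form) and
  `integral_discreteGaussian_cos_le` — **Cor. 4.6** (expectation form):
  `Exp_{x ∼ D_{L,s,c}}[cos(2π⟪x + w, v⟫)] ≤ (1+ε)/(1-ε) · 2⁻ⁿ`.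

## References

* D. Micciancio, O. Regev, *Worst-case to average-case reductions based on Gaussian measures*,
  SIAM J. Comput. 37 (2007) 267–302, Lemma 4.5 and Cor. 4.6 (authors' version pp. 15–16).
* D. Aharonov, O. Regev, *Lattice problems in NP ∩ coNP*, J. ACM 52 (2005), Lemma 3.1.
* J. Neukirch, *Algebraic Number Theory*, Springer 1999, Ch. VII (3.2) (Poisson summation).
-/

noncomputable section

open MeasureTheory Module Metric Filter Complex
open scoped Real ENNReal InnerProductSpace Topology FourierTransform

namespace Literature.Algebra.EuclideanLattices

variable {V : Type*} [NormedAddCommGroup V] [InnerProductSpace ℝ V] [FiniteDimensional ℝ V]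
  [MeasurableSpace V] [BorelSpace V]

/-! ### Modulation and the modulated Poisson identity -/

/-- **Modulation rule for the Fourier integral**: `𝓕[x ↦ 𝐞(⟪x, v⟫) f(x)](w) = 𝓕 f (w - v)`
(immediate from `𝓕 f (w) = ∫ 𝐞(-⟪x, w⟫) f(x) dx` and `𝐞(a)𝐞(b) = 𝐞(a + b)`). [folklore] -/
theorem fourier_fourierChar_smul (f : V → ℂ) (v w : V) :
    𝓕 (fun x : V ↦ 𝐞 ⟪x, v⟫_ℝ • f x) w = 𝓕 f (w - v) := by
  change VectorFourier.fourierIntegral 𝐞 volume (innerₗ V) (fun x : V ↦ 𝐞 ⟪x, v⟫_ℝ • f x) w =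
    VectorFourier.fourierIntegral 𝐞 volume (innerₗ V) f (w - v)
  simp only [VectorFourier.fourierIntegral, innerₗ_apply_apply]
  refine integral_congr_ae (Filter.Eventually.of_forall fun x ↦ ?_)
  simp only [smul_smul, ← AddChar.map_add_eq_mul, inner_sub_right]
  rw [show -⟪x, w⟫_ℝ + ⟪x, v⟫_ℝ = -(⟪x, w⟫_ℝ - ⟪x, v⟫_ℝ) by ring]

variable (L : Submodule ℤ V) [DiscreteTopology L] [IsZLattice ℝ L]

/-- **The modulated Poisson identity for Gaussians**: for a full lattice `L`, `s > 0` and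
`c, v ∈ V`, `∑_{x ∈ L} 𝐞(⟪x, v⟫) ρ_s(x - c) = vol(L)⁻¹ ∑_{y ∈ L*} 𝐞(-⟪c, y - v⟫) sⁿ ρ_{1/s}(y - v)`
(Micciancio–Regev 2007, proof of Lemma 4.5, eq. (11): "`ĝ(y) = ρ̂_c(y - v) = ρ(y - v)e^{-2πi⟨y-v,c⟩}`";
Poisson summation, Neukirch VII (3.2)). [cite: MicciancioRegev2007, Lemma 4.5 (proof, eq. (11), p. 15)] -/
theorem tsum_fourierChar_smul_gaussianFunction_sub_eq {s : ℝ} (hs : 0 < s) (c v : V) :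
    ∑' x : L, 𝐞 ⟪(x : V), v⟫_ℝ • ((gaussianFunction s ((x : V) - c) : ℝ) : ℂ) =
      ((ZLattice.covolume L)⁻¹ : ℝ) • ∑' y : dualLattice L,
        𝐞 (-⟪c, (y : V) - v⟫_ℝ) • (((s ^ finrank ℝ V * gaussianFunction s⁻¹ ((y : V) - v) : ℝ)) : ℂ) := by
  set f : V → ℂ := fun x ↦ 𝐞 ⟪x, v⟫_ℝ • ((gaussianFunction s (x - c) : ℝ) : ℂ) with hf
  have hb : (finrank ℝ V : ℝ) < (finrank ℝ V : ℝ) + 1 := by linarith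
  have hb0 : (0 : ℝ) ≤ (finrank ℝ V : ℝ) + 1 := by positivity
  have hcont : Continuous f := by
    simp only [hf, gaussianFunction]
    fun_prop
  have hdec : ∀ x, ‖f x‖ ≤ Real.exp (((finrank ℝ V : ℝ) + 1) ^ 2 / (4 * (π / s ^ 2))) * (1 + ‖c‖) ^ ((finrank ℝ V : ℝ) + 1) *
      (1 + ‖x‖) ^ (-((finrank ℝ V : ℝ) + 1)) := fun x ↦ by
    rw [hf, Circle.norm_smul]
    exact norm_coe_gaussianFunction_sub_le hs c hb0 x
  have hF : ∀ w : V, 𝓕 f w = 𝐞 (-⟪c, w - v⟫_ℝ) • (((s ^ finrank ℝ V * gaussianFunction s⁻¹ (w - v) : ℝ)) : ℂ) :=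
    fun w ↦ by rw [hf, fourier_fourierChar_smul, fourier_gaussianFunction_sub hs c (w - v)]
  have hsum : Summable fun y : dualLattice L ↦ 𝓕 f (y : V) := by
    simp_rw [hF]
    refine Summable.of_norm ?_
    have hS := (summable_gaussianFunction_sub (dualLattice L) (inv_ne_zero hs.ne') v).mul_left (s ^ finrank ℝ V)
    refine hS.congr fun y ↦ ?_
    rw [Circle.norm_smul, Complex.norm_real, Real.norm_eq_abs,
      abs_of_pos (mul_pos (pow_pos hs _) (gaussianFunction_pos _ _))]
  have key := Literature.NumberTheory.LFunctions.Fourier.tsum_eq_tsum_fourier_of_rpow_decay L hcont hb hdec hsum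
  rw [key]
  congr 1
  exact tsum_congr fun y ↦ hF y

/-- **Bounding the modulated Gaussian sum by the shifted dual mass**:
`|∑_{x ∈ L} 𝐞(⟪x, v⟫) ρ_s(x - c)| ≤ vol(L)⁻¹ sⁿ ρ_{1/s}(L* - v)` (Micciancio–Regev 2007, proof of
Lemma 4.5: "`|ĝ(Λ*)| ≤ ρ(Λ* - v)`"). [cite: MicciancioRegev2007, Lemma 4.5 (proof, p. 15)] -/
theorem norm_tsum_fourierChar_smul_gaussianFunction_sub_le {s : ℝ} (hs : 0 < s) (c v : V) :
    ‖∑' x : L, 𝐞 ⟪(x : V), v⟫_ℝ • ((gaussianFunction s ((x : V) - c) : ℝ) : ℂ)‖ ≤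
      (ZLattice.covolume L)⁻¹ * (s ^ finrank ℝ V * ∑' y : dualLattice L, gaussianFunction s⁻¹ ((y : V) - v)) := by
  rw [tsum_fourierChar_smul_gaussianFunction_sub_eq L hs c v, norm_smul, Real.norm_eq_abs,
    abs_of_pos (inv_pos.2 (ZLattice.covolume_pos L volume))]
  refine mul_le_mul_of_nonneg_left ?_ (inv_nonneg.2 (ZLattice.covolume_pos L volume).le)
  rw [← tsum_mul_left]
  have hS : Summable fun y : dualLattice L ↦ s ^ finrank ℝ V * gaussianFunction s⁻¹ ((y : V) - v) :=
    (summable_gaussianFunction_sub (dualLattice L) (inv_ne_zero hs.ne') v).mul_left (s ^ finrank ℝ V)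
  refine tsum_of_norm_bounded hS.hasSum fun y ↦ ?_
  rw [Circle.norm_smul, Complex.norm_real, Real.norm_eq_abs,
    abs_of_pos (mul_pos (pow_pos hs _) (gaussianFunction_pos _ _))]

omit [MeasurableSpace V] [BorelSpace V] in
/-- **The dual mass above `η_ε`**: `ρ_{1/s}(L*) ≤ 1 + ε` for `0 < ε`, `0 < s`, `η_ε(L) ≤ s`
(`ρ_{1/s}(L*) = 1 + ρ_{1/s}(L* ∖ {0})` and the definition of `η_ε`; Micciancio–Regev 2007, proof of
Lemma 4.5: "`ρ(Λ*) = 1 + ρ(Λ* ∖ {0})`"). [cite: MicciancioRegev2007, Lemma 4.5 (proof, p. 16)] -/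
theorem tsum_gaussianFunction_dual_le_one_add {ε s : ℝ} (hε : 0 < ε) (hs : 0 < s)
    (hηs : smoothingParameter L ε ≤ s) :
    ∑' y : dualLattice L, gaussianFunction s⁻¹ (y : V) ≤ 1 + ε := by
  have hσ : 0 < s⁻¹ := inv_pos.2 hs
  have h1 : ENNReal.ofReal (∑' y : dualLattice L, gaussianFunction s⁻¹ (y : V)) =
      gaussianMass s⁻¹ 0 (dualLattice L : Set V) := by
    rw [gaussianMass_coe_eq_ofReal_tsum (dualLattice L) hσ.ne' 0]
    simp only [sub_zero]
  have h2 : gaussianMass s⁻¹ 0 (dualLattice L : Set V) ≤ ENNReal.ofReal (1 + ε) := by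
    rw [gaussianMass_eq_add_sdiff_zero (dualLattice L) s⁻¹ 0, gaussianFunction_zero,
      ENNReal.ofReal_add zero_le_one hε.le, ENNReal.ofReal_one]
    gcongr
    rw [← one_div]
    exact gaussianMass_dual_le_of_smoothingParameter_le L hε hηs
  exact (ENNReal.ofReal_le_ofReal_iff (by positivity)).1 (h1 ▸ h2)

/-! ### MR07 Lemma 4.5 and Cor. 4.6 -/

/-- **Micciancio–Regev 2007, Lemma 4.5**: for a full-rank lattice `L` in dimension `n`, centre `c`,
a point `v` with `dist(v, L*) ≥ √n/s`, `0 < ε < 1` and `s ≥ η_ε(L)` (`0 < s`),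
`|Exp_{x ∼ D_{L,s,c}}[e^{2πi⟨x, v⟩}]| ≤ (1+ε)/(1-ε) · 2⁻ⁿ`, written as the quotient
`|∑_{x ∈ L} 𝐞(⟪x, v⟫) ρ_s(x - c)| / ρ_{s,c}(L)`. [cite: MicciancioRegev2007, Lemma 4.5] -/
theorem norm_tsum_fourierChar_smul_gaussianFunction_sub_div_le {ε s : ℝ} (hε : 0 < ε) (hε1 : ε < 1)
    (hs : 0 < s) (hηs : smoothingParameter L ε ≤ s) (c : V) {v : V}
    (hv : ∀ y : dualLattice L, Real.sqrt (finrank ℝ V) / s ≤ ‖(y : V) - v‖) :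
    ‖∑' x : L, 𝐞 ⟪(x : V), v⟫_ℝ • ((gaussianFunction s ((x : V) - c) : ℝ) : ℂ)‖ /
        ∑' x : L, gaussianFunction s ((x : V) - c) ≤
      (1 + ε) / (1 - ε) * (2⁻¹ : ℝ) ^ finrank ℝ V := by
  set n : ℕ := finrank ℝ V with hn
  have hcov : 0 < ZLattice.covolume L := ZLattice.covolume_pos L volume
  have hZ : 0 < ∑' x : L, gaussianFunction s ((x : V) - c) := tsum_gaussianFunction_sub_pos L hs.ne' c
  rw [div_le_iff₀ hZ]
  -- numerator: `≤ vol⁻¹ sⁿ ρ_{1/s}(L* - v) ≤ vol⁻¹ sⁿ 2⁻ⁿ ρ_{1/s}(L*) ≤ vol⁻¹ sⁿ 2⁻ⁿ (1 + ε)`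
  have h1 : 1 / Real.sqrt (2 * π) ≤ 1 := by
    rw [div_le_one (Real.sqrt_pos.2 (by positivity))]
    exact Real.one_le_sqrt.2 (by linarith [Real.pi_gt_three])
  have hv' : ∀ y : dualLattice L, 1 * s⁻¹ * Real.sqrt (finrank ℝ V) ≤ ‖(y : V) - v‖ := fun y ↦ by
    rw [one_mul, inv_mul_eq_div]; exact hv y
  have hshift := tsum_gaussianFunction_sub_le_pow_mul_of_forall_le (dualLattice L) (inv_pos.2 hs) h1 hv'
  simp only [one_mul, one_pow, mul_one] at hshift
  have hC : (Real.sqrt (2 * π * Real.exp 1) * Real.exp (-π)) ^ n ≤ (2⁻¹ : ℝ) ^ n :=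
    pow_le_pow_left₀ (by positivity) sqrt_two_pi_e_mul_exp_neg_pi_le _
  have hdual := tsum_gaussianFunction_dual_le_one_add L hε hs hηs
  have hρ0 : 0 ≤ ∑' y : dualLattice L, gaussianFunction s⁻¹ (y : V) := tsum_nonneg fun _ ↦ (gaussianFunction_pos _ _).le
  have hnum : ‖∑' x : L, 𝐞 ⟪(x : V), v⟫_ℝ • ((gaussianFunction s ((x : V) - c) : ℝ) : ℂ)‖ ≤
      (ZLattice.covolume L)⁻¹ * (s ^ n * ((2⁻¹ : ℝ) ^ n * (1 + ε))) := by
    refine (norm_tsum_fourierChar_smul_gaussianFunction_sub_le L hs c v).trans ?_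
    gcongr
    calc ∑' y : dualLattice L, gaussianFunction s⁻¹ ((y : V) - v)
        ≤ (Real.sqrt (2 * π * Real.exp 1) * Real.exp (-π)) ^ n * ∑' y : dualLattice L, gaussianFunction s⁻¹ (y : V) :=
          hshift
      _ ≤ (2⁻¹ : ℝ) ^ n * ∑' y : dualLattice L, gaussianFunction s⁻¹ (y : V) := mul_le_mul_of_nonneg_right hC hρ0
      _ ≤ (2⁻¹ : ℝ) ^ n * (1 + ε) := mul_le_mul_of_nonneg_left hdual (by positivity)
  -- denominator: `≥ (1 - ε) sⁿ / vol`
  have hden := le_tsum_gaussianFunction_sub_of_smoothingParameter_le L hε hs hηs c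
  have h1ε : 0 < 1 - ε := by linarith
  calc ‖∑' x : L, 𝐞 ⟪(x : V), v⟫_ℝ • ((gaussianFunction s ((x : V) - c) : ℝ) : ℂ)‖
      ≤ (ZLattice.covolume L)⁻¹ * (s ^ n * ((2⁻¹ : ℝ) ^ n * (1 + ε))) := hnum
    _ = (1 + ε) / (1 - ε) * (2⁻¹ : ℝ) ^ n * ((1 - ε) * (s ^ n / ZLattice.covolume L)) := by
        field_simp
    _ ≤ (1 + ε) / (1 - ε) * (2⁻¹ : ℝ) ^ n * ∑' x : L, gaussianFunction s ((x : V) - c) :=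
        mul_le_mul_of_nonneg_left hden (by positivity)

omit [MeasurableSpace V] [BorelSpace V] [IsZLattice ℝ L] in
/-- The cosine series as the real part of the modulated series, with the phase `𝐞(⟪w, v⟫)` factored:
`∑_{x ∈ L} ρ_s(x - c) cos(2π⟪x + w, v⟫) = Re (𝐞(⟪w, v⟫) ∑_{x ∈ L} 𝐞(⟪x, v⟫) ρ_s(x - c))`.
[cite: MicciancioRegev2007, Cor. 4.6 (proof, p. 16)] -/
theorem tsum_gaussianFunction_sub_mul_cos_eq_re {s : ℝ} (hs : 0 < s) (c v w : V) :
    ∑' x : L, gaussianFunction s ((x : V) - c) * Real.cos (2 * π * ⟪(x : V) + w, v⟫_ℝ) =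
      ((𝐞 ⟪w, v⟫_ℝ : ℂ) * ∑' x : L, 𝐞 ⟪(x : V), v⟫_ℝ • ((gaussianFunction s ((x : V) - c) : ℝ) : ℂ)).re := by
  have hsumC : Summable fun x : L ↦ 𝐞 ⟪(x : V), v⟫_ℝ • ((gaussianFunction s ((x : V) - c) : ℝ) : ℂ) := by
    refine Summable.of_norm ?_
    refine (summable_gaussianFunction_sub L hs.ne' c).congr fun x ↦ ?_
    rw [Circle.norm_smul, Complex.norm_real, Real.norm_eq_abs, abs_of_pos (gaussianFunction_pos _ _)]
  rw [← tsum_mul_left, Complex.re_tsum (hsumC.mul_left _)]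
  refine tsum_congr fun x ↦ ?_
  rw [Circle.smul_def, smul_eq_mul, ← mul_assoc, ← Circle.coe_mul, ← AddChar.map_add_eq_mul,
    Real.fourierChar_apply, Complex.re_mul_ofReal, Complex.exp_ofReal_mul_I_re, inner_add_left,
    add_comm ⟪(x : V), v⟫_ℝ, mul_comm]

/-- **Micciancio–Regev 2007, Cor. 4.6 (series form)**: for a full-rank lattice `L` in dimension
`n`, `w, c, v ∈ V` with `dist(v, L*) ≥ √n/s`, `0 < ε < 1`, `0 < s`, `η_ε(L) ≤ s`:
`(∑_{x ∈ L} ρ_s(x - c) cos(2π⟪x + w, v⟫)) / ρ_{s,c}(L) ≤ (1+ε)/(1-ε) · 2⁻ⁿ` — the real part of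
`𝐞(⟪w, v⟫) Exp[e^{2πi⟨x, v⟩}]` is at most its modulus (Lemma 4.5). [cite: MicciancioRegev2007, Cor. 4.6] -/
theorem tsum_gaussianFunction_sub_mul_cos_div_le {ε s : ℝ} (hε : 0 < ε) (hε1 : ε < 1) (hs : 0 < s)
    (hηs : smoothingParameter L ε ≤ s) (c w : V) {v : V}
    (hv : ∀ y : dualLattice L, Real.sqrt (finrank ℝ V) / s ≤ ‖(y : V) - v‖) :
    (∑' x : L, gaussianFunction s ((x : V) - c) * Real.cos (2 * π * ⟪(x : V) + w, v⟫_ℝ)) /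
        ∑' x : L, gaussianFunction s ((x : V) - c) ≤
      (1 + ε) / (1 - ε) * (2⁻¹ : ℝ) ^ finrank ℝ V := by
  have hZ : 0 < ∑' x : L, gaussianFunction s ((x : V) - c) := tsum_gaussianFunction_sub_pos L hs.ne' c
  refine le_trans ?_ (norm_tsum_fourierChar_smul_gaussianFunction_sub_div_le L hε hε1 hs hηs c hv)
  rw [tsum_gaussianFunction_sub_mul_cos_eq_re L hs c v w]
  refine div_le_div_of_nonneg_right ((Complex.re_le_norm _).trans ?_) hZ.le
  rw [norm_mul, Circle.norm_coe, one_mul]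

/-- **Micciancio–Regev 2007, Cor. 4.6 (expectation form)**: for a full-rank lattice `L` in
dimension `n`, `w, c, v ∈ V` with `dist(v, L*) ≥ √n/s`, `0 < ε < 1`, `0 < s`, `η_ε(L) ≤ s`:
`Exp_{x ∼ D_{L,s,c}}[cos(2π⟨x + w, v⟩)] ≤ (1+ε)/(1-ε) · 2⁻ⁿ`. [cite: MicciancioRegev2007, Cor. 4.6] -/
theorem integral_discreteGaussian_cos_le {ε s : ℝ} (hε : 0 < ε) (hε1 : ε < 1) (hs : 0 < s)
    (hηs : smoothingParameter L ε ≤ s) (c w : V) {v : V}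
    (hv : ∀ y : dualLattice L, Real.sqrt (finrank ℝ V) / s ≤ ‖(y : V) - v‖) :
    ∫ x, Real.cos (2 * π * ⟪(x : V) + w, v⟫_ℝ) ∂(discreteGaussian L s c).toMeasure ≤
      (1 + ε) / (1 - ε) * (2⁻¹ : ℝ) ^ finrank ℝ V := by
  rw [integral_discreteGaussian_eq L hs c (M := 1) fun x ↦ Real.abs_cos_le_one _]
  exact tsum_gaussianFunction_sub_mul_cos_div_le L hε hε1 hs hηs c w hv

end Literature.Algebra.EuclideanLattices

end
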